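import Summits.RiemannHypothesis.RiemannHypothesis.Theorems.SemilocalDeletionCompression
import Summits.RiemannHypothesis.RiemannHypothesis.Theorems.SemilocalDeletionCompressionCeiling
import HarnessLib

/-!
# The TWO-LEVEL DEFECT SANDWICH `r²/(κ − π + r²/(κ − π)) ≤ π − λ_min ≤ r²/(γ − π)`

One statement packaging the floor (`SemilocalDeletionCompression`, Temple form: block `1` = ONE trial function `v`) and the
two-level Ritz ceiling (`SemilocalDeletionCompressionCeiling`) — the theorem side of the TWO-LEVEL LAW of the ζ-null-space
compression defect (seat cc-s2-1 gen15; three separately sealed blind files PREREG-ccs21-g15-twolevel / -twolevel2 / -twolevel3,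
147/147 cells: `π − ε₁ = ρ·(π − λ₋(π, κ, r))`, `ρ ∈ [1.012, 1.201]`).

Setting (any finite `S`, window `c`, constraint `P` stable under nonnegative combinations): a trial function `v` on the window
with quotient `π = Re Q_S(v)/‖v‖₂²` (in the numerics: the bottom vector of the compressed form), a second function `z ⊥ v` on the
window with quotient `≤ κ` and cross form `Re C_S(v, z) ≤ −2r‖v‖₂‖z‖₂` (the direction of `v`'s residual, `r` = its norm), and a
floor `γ > π` for the form on the admissible functions orthogonal to `v` with the residual coupling bound `|Re C_S(a v, w)| ≤ 2r‖a v‖₂‖w‖₂`.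
Then (`semilocalGroundEnergy_mem_twoLevel_sandwich`)

  `π − r²/(γ − π) ≤ λ_min(S; c; P) ≤ π − r²/(κ − π + r²/(κ − π))`,

i.e. the DEFECT `π − λ_min` lies in `[r²/(κ − π + r²/(κ − π)), r²/(γ − π)]` (`γ ≤ κ` necessarily when `z` itself is admissible and
orthogonal to `v`).  Statements about truncated Weil forms only; nothing here bears on RH.
-/

set_option linter.dupNamespace false

noncomputable section

open Complex Filter Set MeasureTheory
open scoped Real Topology ComplexConjugate

namespace Summit.RiemannHypothesis.RiemannHypothesis.Theorems.SemilocalDeletionCompressionTwoLevel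

open Literature.NumberTheory.LFunctions
open Summit.RiemannHypothesis.RiemannHypothesis.Theorems.HandoffSemilocalEnergy
open Summit.RiemannHypothesis.RiemannHypothesis.Theorems.SemilocalDeletionCompression
open Summit.RiemannHypothesis.RiemannHypothesis.Theorems.SemilocalDeletionCompressionCeiling

variable {S : Finset ℕ} {P : (ℝ → ℂ) → Prop} {c q κ γ r : ℝ} {v z : ℝ → ℂ}

/-- **TWO-LEVEL DEFECT SANDWICH.**  `v`, `z` Weil tests on `[−c, c]`, `z ⊥ v`, `‖v‖₂, ‖z‖₂ ≠ 0`, `Re Q_S(v) = π‖v‖₂²`,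
`Re Q_S(z) ≤ κ‖z‖₂²`, `Re C_S(v, z) ≤ −2r‖v‖₂‖z‖₂` (`r ≥ 0`, `π < κ`), `P` stable under nonnegative combinations of `v`, `z`; and every
admissible `g` splits as `a·v + w` with `w ⊥ a·v`, `Re Q_S(w) ≥ γ‖w‖₂²` (`γ > π`) and `|Re C_S(a·v, w)| ≤ 2r‖a·v‖₂‖w‖₂`.  Then
`π − r²/(γ − π) ≤ λ_min(S; c; P) ≤ π − r²/(κ − π + r²/(κ − π))` (`π` is the variable `q` below). -/
theorem semilocalGroundEnergy_mem_twoLevel_sandwich (hv : IsWeilTest v) (hz : IsWeilTest z) (hvs : tsupport v ⊆ Icc (-c) c)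
    (hzs : tsupport z ⊆ Icc (-c) c) (horth : ∫ t, v t * conj (z t) = 0) (hv0 : 0 < ∫ t, ‖v t‖ ^ 2) (hz0 : 0 < ∫ t, ‖z t‖ ^ 2)
    (hr : 0 ≤ r) (hqκ : q < κ) (hqγ : q < γ)
    (hq : (weilSemilocalQuadratic S v).re = q * ∫ t, ‖v t‖ ^ 2)
    (hκ : (weilSemilocalQuadratic S z).re ≤ κ * ∫ t, ‖z t‖ ^ 2)
    (hC : (weilSemilocalFunctional S (weilConv v (weilReflect z)) + weilSemilocalFunctional S (weilConv z (weilReflect v))).re ≤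
      -(2 * r * Real.sqrt (∫ t, ‖v t‖ ^ 2) * Real.sqrt (∫ t, ‖z t‖ ^ 2)))
    (hP : ∀ a b : ℝ, 0 ≤ a → 0 ≤ b → P fun t ↦ (a : ℂ) * v t + (b : ℂ) * z t)
    (hsplit : ∀ g : ℝ → ℂ, IsWeilTest g → tsupport g ⊆ Icc (-c) c → P g →
      ∃ (a : ℂ) (w : ℝ → ℂ), IsWeilTest w ∧ g = (fun t ↦ a * v t) + w ∧ (∫ t, a * v t * conj (w t) = 0) ∧
        γ * ∫ t, ‖w t‖ ^ 2 ≤ (weilSemilocalQuadratic S w).re ∧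
        |(weilSemilocalFunctional S (weilConv (fun t ↦ a * v t) (weilReflect w)) +
            weilSemilocalFunctional S (weilConv w (weilReflect fun t ↦ a * v t))).re| ≤
          2 * r * Real.sqrt (∫ t, ‖a * v t‖ ^ 2) * Real.sqrt (∫ t, ‖w t‖ ^ 2)) :
    q - r ^ 2 / (γ - q) ≤ semilocalGroundEnergy S P c ∧
      semilocalGroundEnergy S P c ≤ q - r ^ 2 / (κ - q + r ^ 2 / (κ - q)) := by
  constructor
  · -- FLOOR (Temple form of the two-block sandwich): block 1 = the multiples of `v`
    have hne : (semilocalSphereValues S P c).Nonempty := by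
      -- the normalised `v` is on the sphere
      obtain ⟨A, hA0, hA2⟩ : ∃ A : ℝ, 0 < A ∧ A ^ 2 = ∫ t, ‖v t‖ ^ 2 := ⟨_, Real.sqrt_pos.2 hv0, Real.sq_sqrt hv0.le⟩
      refine ⟨_, ⟨fun t ↦ ((A⁻¹ : ℝ) : ℂ) * v t, hv.const_mul _, tsupport_mul_subset_right.trans hvs, ?_, ?_, rfl⟩⟩
      · have := hP A⁻¹ 0 (inv_nonneg.2 hA0.le) le_rfl
        simpa using this
      · have hsc : ∫ t, ‖((A⁻¹ : ℝ) : ℂ) * v t‖ ^ 2 = (A⁻¹) ^ 2 * ∫ t, ‖v t‖ ^ 2 := by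
          simp only [norm_mul, mul_pow, Complex.norm_real, Real.norm_eq_abs, sq_abs]
          exact integral_const_mul _ _
        rw [hsc, ← hA2, inv_pow, inv_mul_cancel₀ (pow_ne_zero 2 hA0.ne')]
    refine sub_div_le_semilocalGroundEnergy (m₁ := q) (m₂ := γ) (β := r) hne hqγ fun g hg hs hPg ↦ ?_
    obtain ⟨a, w, hw, hgaw, horth', hγw, hCw⟩ := hsplit g hg hs hPg
    refine ⟨fun t ↦ a * v t, w, hv.const_mul a, hw, hgaw, horth', le_of_eq ?_, hγw, hCw⟩
    -- `Re Q_S(a v) = q‖a v‖²`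
    rw [weilSemilocalQuadratic_const_mul, Complex.re_ofReal_mul, hq]
    have hsc : ∫ t, ‖a * v t‖ ^ 2 = Complex.normSq a * ∫ t, ‖v t‖ ^ 2 := by
      rw [← integral_const_mul]; congr 1 with t; rw [norm_mul, mul_pow, Complex.normSq_eq_norm_sq]
    rw [hsc]; ring
  · -- CEILING (two-level Ritz on `span{v, z}`)
    have hq' : (weilSemilocalQuadratic S v).re ≤ q * ∫ t, ‖v t‖ ^ 2 := le_of_eq hq
    exact semilocalGroundEnergy_le_sub_div hv hz hvs hzs horth hv0 hz0 hr hqκ hP hq' hκ hC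

end Summit.RiemannHypothesis.RiemannHypothesis.Theorems.SemilocalDeletionCompressionTwoLevel
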